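/-
Copyright (c) 2026. All rights reserved.
Released under Apache 2.0 license as described in the file LICENSE.
-/
import Summits.CriticalPhenomena.LaceExpansionHighD.NobleBoundsNMidSCornerLetter
import HarnessLib

/-!
# Fitzner–van der Hofstad (2017), Prop. 5.5 (5.34) at `N = M + 2` against the SHARP blocks, hypothesis-free — Part I
§E: the corner `w_1 = t_0` (`R′`) cell packages of the FIRST junction against `A♯` (bodies = the off-corner `F‴`
packages of `NobleBoundsNFirstSOpen` verbatim except for the exit letter) (WHAT-IF, DIVERGENCE D77; b2b-lace LEMMAS
node N76-X2-D77, module 3/11)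

[FvdH17] = R. Fitzner, R. van der Hofstad, *Mean-field behavior for nearest-neighbor percolation in `d > 10`*,
arXiv:1506.07977v2 (EJP 22 (2017), paper 43).  Page numbers refer to the arXiv version.

SPLIT PROVENANCE: module 3 of 11 of the b2b-lace node N76-X2-D77 (what-if, DIVERGENCE D77) — the 11 modules are the
section-seam split (carver-g217, 2026-08-27) of the single-module form `NobleBoundsNSharpD77.lean` (carver-g51
text-final, sha256 `877e12977f9f9c92`, 2707 lines): every declaration, statement and proof is carried over verbatim and
in the original order; only module boundaries, the repeated `section`/`variable` headers and two docstrings were added.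
PLACEMENT: what-if objects of `NobleBlocksSharp` (b2b-lace LEAN PLACEMENT RULE, REFEREE R491), hence
`namespace Summit.CriticalPhenomena.LaceExpansionHighD.NobleBlocks`.  Conventions: `d`-generic; every declaration
carries its [FvdH17] display / page cite in the docstring; NOTHING is cited as a fact (b2b-lace ABSOLUTE RULE);
additive (no existing declaration is changed). -/

noncomputable section

namespace Summit.CriticalPhenomena.LaceExpansionHighD.NobleBlocks

open Literature.Probability.FitznerVanDerHofstad2017 Literature.Probability.FitznerVanDerHofstad2017.NobleBlocks
open Literature.Probability.FitznerVanDerHofstad2017.NobleBlocks.LenIdx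
open Literature.Probability.LatticeModels Literature.Probability.Percolation
open Literature.Probability.FitznerVanDerHofstad2017.BlockSummation
open Literature.Barriers.CriticalPhenomena
open Literature.Combinatorics.SimpleGraph _root_.SimpleGraph _root_.MeasureTheory
open scoped BigOperators ENNReal Matrix

variable {d : ℕ}

section Packages

variable (p : unitInterval) (M : ℕ) (x : Site d) (b : Fin (M + 2) → Site d × Site d) (w t z : Fin (M + 2) → Site d)
  (a : Fin (M + 2) → Fin 3 ⊕ Unit) (c : Fin 3 ⊕ Unit) (τ : Fin (M + 1) → Bool × Fin 3)

/-! ### E. The FIRST junction on the corner `w_1 = t_0` -/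

/-- **Cells `(a_0, 0, a_1)`, `a_0 ∈ {0,1,2}`, `a_1 ∈ {1,2}`, variant `F‴`, of the FIRST junction, ON THE CORNER
`w_1 = t_0`, against the PRIMED entry letter**: target
`P^{S,a_0}(u_0,w_0) · (A'^{κ,a_0,0,*}(u_0,w_0,t_0,z_0) · A♯^{0,a_1}(t_0,z_0,w_1,u_1))`.
[cite: FitznerVanDerHofstad2017, §6.1 (6.4)–(6.10), "Case a = 0 / 1 / ≥ 2", "Case b = 1, ≥ 2" (arXiv:1506.07977v2 pp. 58–59); §5.1 (5.1)–(5.4) (pp. 46–48); App. B (pp. 73–75); §4.4 (4.61), (4.64), text after (4.66) (pp. 41–42)] -/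
theorem nonempty_jPkg_firstS_zero_corner' (κ : Fin d × Bool)
    (hb : (b (0 : Fin (M + 1)).castSucc).2 = (b (0 : Fin (M + 1)).castSucc).1 + stepVec κ) (hσ : (τ 0).1 = false)
    (hc0 : (τ 0).2 = 0) (a₀ : Fin 3) (ha : a (0 : Fin (M + 1)).castSucc = Sum.inl a₀) {a' : Fin 3}
    (ha' : a (0 : Fin (M + 1)).succ = Sum.inl a') (ha'0 : a' ≠ 0)
    (hwt : w (0 : Fin (M + 1)).succ = t (0 : Fin (M + 1)).castSucc) :
    Nonempty (JPkg p (jctx M x b w t z a τ (0 : Fin (M + 1)).castSucc) (JFacts M x b w t z a c τ)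
      (blockPS (Letters.perc d p) a₀ (b (0 : Fin (M + 1)).castSucc).1 (w (0 : Fin (M + 1)).castSucc) *
        (blockAiotaSt' (Letters.perc d p) κ a₀ 0 (b (0 : Fin (M + 1)).castSucc).1 (w (0 : Fin (M + 1)).castSucc)
            (t (0 : Fin (M + 1)).castSucc) (z (0 : Fin (M + 1)).castSucc) *
          blockASharp (Letters.perc d p) 0 a' (t (0 : Fin (M + 1)).castSucc) (z (0 : Fin (M + 1)).castSucc)
            (w (0 : Fin (M + 1)).succ) (b (0 : Fin (M + 1)).succ).1))) := by
  -- degenerate parameters: the piece is empty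
  by_cases hP : (t (0 : Fin (M + 1)).castSucc ≠ (b (0 : Fin (M + 1)).succ).1 ∧
      (a' ≠ 0 → w (0 : Fin (M + 1)).succ ≠ (b (0 : Fin (M + 1)).succ).1) ∧
      ((τ 0).2 = 0 → t (0 : Fin (M + 1)).castSucc = z (0 : Fin (M + 1)).castSucc) ∧
      ((τ 0).2 = 1 → (zdGraph d).Adj (t (0 : Fin (M + 1)).castSucc) (z (0 : Fin (M + 1)).castSucc))) ∧
      (b (0 : Fin (M + 1)).castSucc).1 ≠ t (0 : Fin (M + 1)).castSucc ∧
      (b (0 : Fin (M + 1)).castSucc).1 ≠ z (0 : Fin (M + 1)).castSucc ∧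
      (b (0 : Fin (M + 1)).castSucc).2 ≠ z (0 : Fin (M + 1)).castSucc ∧
      ((b (0 : Fin (M + 1)).castSucc).1 = 0 → w (0 : Fin (M + 1)).castSucc = 0) ∧
      (a₀ = 0 → w (0 : Fin (M + 1)).castSucc = (b (0 : Fin (M + 1)).castSucc).1) ∧
      (a₀ = 1 → (zdGraph d).Adj (b (0 : Fin (M + 1)).castSucc).1 (w (0 : Fin (M + 1)).castSucc)) ∧
      (a₀ = 2 → (b (0 : Fin (M + 1)).castSucc).1 ≠ w (0 : Fin (M + 1)).castSucc)
  swap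
  · refine ⟨JPkg.vacuous p _ _ (fun ω K₀ hF => hP ?_) _⟩
    obtain ⟨-, hty, hut, huz, hvz, hcan, hw0, hw1, hw2, hw', -, hc0', -, hc1, -⟩ :=
      firstSOpen_facts M x b w t z a c τ hF hσ ha ha'
    exact ⟨⟨hty, hw', hc0', fun h => (hc1 h).1⟩, hut, huz, hvz, hcan, hw0, hw1, hw2⟩
  obtain ⟨hQ, hut, huz, hvz, hcan, hw0, hw1, hw2⟩ := hP
  have htz : t (0 : Fin (M + 1)).castSucc = z (0 : Fin (M + 1)).castSucc := hQ.2.2.1 hc0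
  obtain ⟨X0, X1, X2, f0, f1, f2, hmem₀, hrow₀⟩ :=
    first_startLetter_gl p M x b w t z a c τ glFirstS3 true false (.lo 0) rfl rfl rfl ha hcan hw0 hw1 hw2
  obtain ⟨E3, E4, g3, g4, hmem₂, hrow₂⟩ :=
    midS_cornerLetter_piPerc p M x b w t z a c τ 0 hσ ha' ha'0 0 hwt hQ hc0
  refine nonempty_jPkg_firstSOpen_core p M x b w t z a c τ κ hb hσ ha' X0 X1 X2
    (endX a₀ (b (0 : Fin (M + 1)).castSucc).1 (w (0 : Fin (M + 1)).castSucc) (z (0 : Fin (M + 1)).castSucc))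
    (event (ge 1) (b (0 : Fin (M + 1)).castSucc).2 (t (0 : Fin (M + 1)).castSucc)) Set.univ Set.univ E3 E4 f0 f1 f2
    (isFinitary_endX _ _ _ _) (isFinitary_event _ _ _) isFinitary_univ isFinitary_univ g3 g4
    (fun ω K₀ hF => ⟨(hmem₀ ω K₀ hF).1, (hmem₀ ω K₀ hF).2.1, (hmem₀ ω K₀ hF).2.2,
      firstSOpen_exit_mem M x b w t z a c τ hF huz hw0, ?_, Set.mem_univ _, Set.mem_univ _,
      (hmem₂ ω K₀ hF).1, (hmem₂ ω K₀ hF).2⟩)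
    (hrow₀ _ rfl rfl rfl) ?_ ((junF_firstSCorner_up_le₂ p M x b w t z a τ hσ ha' _ _ _ _ _ _ _ _ _ _).trans hrow₂)
  · obtain ⟨h0, -⟩ := hF.conn_midS 0 hσ ha'
    rw [event_ge]; exact mem_openConnGe_one_of_ne h0 (by rw [htz]; exact hvz)
  · refine (junF_firstSOpen_xb_le₃ p M x b w t z a τ hσ ha' _ _ _ _ _ _ _ _ _ _).trans ?_
    rw [← htz]
    unfold endX
    split_ifs with h0
    · subst h0
      rw [hw0 rfl]
      exact piPerc_midS_zero_zero_le_blockAiotaSt' p hb (by rw [htz]; exact hvz.symm) (fun h => hut h.symm) _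
    · obtain h1 | h2 : a₀ = 1 ∨ a₀ = 2 := by
        fin_cases a₀
        · exact absurd rfl h0
        · exact Or.inl rfl
        · exact Or.inr rfl
      · subst h1
        obtain ⟨κ', hκ'⟩ := (zdGraph_adj_iff_stepVec _ _).1 (hw1 rfl)
        rw [blockAiotaSt'_of_ne _ _ (fun h => absurd h.1 (by decide))]
        exact piPerc_midS_one_zero_le_blockAiotaSt p hb hκ' (fun h => hut h.symm) _
      · subst h2
        rw [blockAiotaSt'_of_ne _ _ (fun h => absurd h.1 (by decide))]
        exact piPerc_midS_two_zero_le_blockAiotaSt p hb _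

/-- **Cells `(a_0, 1, a_1)`, `a_0 ∈ {0,1,2}`, `a_1 ∈ {1,2}`, variant `F‴`, of the first junction, ON THE CORNER
`w_1 = t_0`**: target `P^{S,a_0}(u_0,w_0) · (A^{κ,a_0,1,*}(u_0,w_0,t_0,z_0) · A♯^{1,a_1}(t_0,z_0,w_1,u_1))`.
[cite: FitznerVanDerHofstad2017, §6.1 (6.4)–(6.10), "Case a = 0 / 1 / ≥ 2", "Case b = 1, ≥ 2" (arXiv:1506.07977v2 pp. 58–59); §5.1 (5.1)–(5.4) (pp. 46–48); App. B (pp. 73–75); §4.4 (4.61), (4.64), text after (4.66) (pp. 41–42)] -/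
theorem nonempty_jPkg_firstS_one_corner (κ : Fin d × Bool)
    (hb : (b (0 : Fin (M + 1)).castSucc).2 = (b (0 : Fin (M + 1)).castSucc).1 + stepVec κ) (hσ : (τ 0).1 = false)
    (hc1 : (τ 0).2 = 1) (a₀ : Fin 3) (ha : a (0 : Fin (M + 1)).castSucc = Sum.inl a₀) {a' : Fin 3}
    (ha' : a (0 : Fin (M + 1)).succ = Sum.inl a') (ha'0 : a' ≠ 0)
    (hwt : w (0 : Fin (M + 1)).succ = t (0 : Fin (M + 1)).castSucc) :
    Nonempty (JPkg p (jctx M x b w t z a τ (0 : Fin (M + 1)).castSucc) (JFacts M x b w t z a c τ)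
      (blockPS (Letters.perc d p) a₀ (b (0 : Fin (M + 1)).castSucc).1 (w (0 : Fin (M + 1)).castSucc) *
        (blockAiotaSt (Letters.perc d p) κ a₀ 1 (b (0 : Fin (M + 1)).castSucc).1 (w (0 : Fin (M + 1)).castSucc)
            (t (0 : Fin (M + 1)).castSucc) (z (0 : Fin (M + 1)).castSucc) *
          blockASharp (Letters.perc d p) 1 a' (t (0 : Fin (M + 1)).castSucc) (z (0 : Fin (M + 1)).castSucc)
            (w (0 : Fin (M + 1)).succ) (b (0 : Fin (M + 1)).succ).1))) := by
  -- degenerate parameters: the piece is empty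
  by_cases hP : (t (0 : Fin (M + 1)).castSucc ≠ (b (0 : Fin (M + 1)).succ).1 ∧
      (a' ≠ 0 → w (0 : Fin (M + 1)).succ ≠ (b (0 : Fin (M + 1)).succ).1) ∧
      ((τ 0).2 = 0 → t (0 : Fin (M + 1)).castSucc = z (0 : Fin (M + 1)).castSucc) ∧
      ((τ 0).2 = 1 → (zdGraph d).Adj (t (0 : Fin (M + 1)).castSucc) (z (0 : Fin (M + 1)).castSucc))) ∧
      (b (0 : Fin (M + 1)).castSucc).1 ≠ t (0 : Fin (M + 1)).castSucc ∧
      (b (0 : Fin (M + 1)).castSucc).1 ≠ z (0 : Fin (M + 1)).castSucc ∧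
      (b (0 : Fin (M + 1)).castSucc).2 ≠ z (0 : Fin (M + 1)).castSucc ∧
      ((b (0 : Fin (M + 1)).castSucc).1 = 0 → w (0 : Fin (M + 1)).castSucc = 0) ∧
      (a₀ = 0 → w (0 : Fin (M + 1)).castSucc = (b (0 : Fin (M + 1)).castSucc).1) ∧
      (a₀ = 1 → (zdGraph d).Adj (b (0 : Fin (M + 1)).castSucc).1 (w (0 : Fin (M + 1)).castSucc)) ∧
      (a₀ = 2 → (b (0 : Fin (M + 1)).castSucc).1 ≠ w (0 : Fin (M + 1)).castSucc) ∧
      t (0 : Fin (M + 1)).castSucc ≠ z (0 : Fin (M + 1)).castSucc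
  swap
  · refine ⟨JPkg.vacuous p _ _ (fun ω K₀ hF => hP ?_) _⟩
    obtain ⟨-, hty, hut, huz, hvz, hcan, hw0, hw1, hw2, hw', -, hc0', hcn, hc1', -⟩ :=
      firstSOpen_facts M x b w t z a c τ hF hσ ha ha'
    exact ⟨⟨hty, hw', hc0', fun h => (hc1' h).1⟩, hut, huz, hvz, hcan, hw0, hw1, hw2, hcn (by rw [hc1]; decide)⟩
  obtain ⟨hQ, hut, huz, hvz, hcan, hw0, hw1, hw2, htz⟩ := hP
  have hadj : (zdGraph d).Adj (t (0 : Fin (M + 1)).castSucc) (z (0 : Fin (M + 1)).castSucc) := hQ.2.2.2 hc1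
  obtain ⟨X0, X1, X2, f0, f1, f2, hmem₀, hrow₀⟩ :=
    first_startLetter_gl p M x b w t z a c τ glFirstS3 true false (.lo 0) rfl rfl rfl ha hcan hw0 hw1 hw2
  obtain ⟨E3, E4, g3, g4, hmem₂, hrow₂⟩ :=
    midS_cornerLetter_piPerc p M x b w t z a c τ 0 hσ ha' ha'0 1 hwt hQ hc1
  -- the open sausage bond is its own witness
  have hbond : ∀ ω K₀, JFacts M x b w t z a c τ ω K₀ →
      K₀ (0 : Fin (M + 1)).castSucc.succ 1 ∈
        (event (eq 1) (t (0 : Fin (M + 1)).castSucc) (z (0 : Fin (M + 1)).castSucc) : Set (BondConfig (Site d))) := by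
    intro ω K₀ hF
    obtain ⟨-, -, -, -, -, -, -, -, -, -, -, -, -, hc1', -⟩ := firstSOpen_facts M x b w t z a c τ hF hσ ha ha'
    rw [hF.tz_witness_midS 0 hσ ha' htz (hc1' hc1).2]
    exact singleton_mem_event_eq_one htz
  by_cases h0 : a₀ = 0
  · subst h0
    have hwu : w (0 : Fin (M + 1)).castSucc = (b (0 : Fin (M + 1)).castSucc).1 := hw0 rfl
    by_cases hx : t (0 : Fin (M + 1)).castSucc = (b (0 : Fin (M + 1)).castSucc).2
    · -- sub-row `x = e`: triangle, exit line of length `≥ 2` by parity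
      refine nonempty_jPkg_firstSOpen_core p M x b w t z a c τ κ hb hσ ha' X0 X1 X2
        (event (ge 2) (z (0 : Fin (M + 1)).castSucc) (b (0 : Fin (M + 1)).castSucc).1) Set.univ
        (event (eq 1) (t (0 : Fin (M + 1)).castSucc) (z (0 : Fin (M + 1)).castSucc)) Set.univ E3 E4 f0 f1 f2
        (isFinitary_event _ _ _) isFinitary_univ (isFinitary_event _ _ _) isFinitary_univ g3 g4
        (fun ω K₀ hF => ⟨(hmem₀ ω K₀ hF).1, (hmem₀ ω K₀ hF).2.1, (hmem₀ ω K₀ hF).2.2, ?_, Set.mem_univ _,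
          hbond ω K₀ hF, Set.mem_univ _, (hmem₂ ω K₀ hF).1, (hmem₂ ω K₀ hF).2⟩)
        (hrow₀ _ rfl rfl rfl) ?_ ((junF_firstSCorner_up_le₂ p M x b w t z a τ hσ ha' _ _ _ _ _ _ _ _ _ _).trans hrow₂)
      · obtain ⟨-, -, h3⟩ := hF.conn_first
        rw [hwu] at h3
        have hadj' : (zdGraph d).Adj (b (0 : Fin (M + 1)).castSucc).1 (b (0 : Fin (M + 1)).castSucc).2 :=
          (zdGraph_adj_iff_stepVec _ _).2 ⟨κ, hb⟩
        have hna : ¬ (zdGraph d).Adj (b (0 : Fin (M + 1)).castSucc).1 (z (0 : Fin (M + 1)).castSucc) :=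
          not_adj_of_adj_adj hadj' (by rw [← hx]; exact hadj)
        rw [event_comm, event_ge]
        refine mem_openConnGe_two_of_notMem h3 huz fun hm => hna ?_
        exact (SimpleGraph.mem_edgeSet _).1 (hF.lattice _ (hF.witness_subset _ 3 hm))
      · refine (junF_firstSOpen_xb_le₃' p M x b w t z a τ hσ ha' _ _ _ _ _ _ _ _ _ _).trans ?_
        rw [hwu, hx]
        exact piPerc_midS_zero_one_e_le_blockAiotaSt p hb (fun h => huz h.symm) _
    · -- sub-row `x ≠ e`: square
      refine nonempty_jPkg_firstSOpen_core p M x b w t z a c τ κ hb hσ ha' X0 X1 X2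
        (event (ge 1) (z (0 : Fin (M + 1)).castSucc) (b (0 : Fin (M + 1)).castSucc).1)
        (event (ge 1) (b (0 : Fin (M + 1)).castSucc).2 (t (0 : Fin (M + 1)).castSucc))
        (event (eq 1) (t (0 : Fin (M + 1)).castSucc) (z (0 : Fin (M + 1)).castSucc)) Set.univ E3 E4 f0 f1 f2
        (isFinitary_event _ _ _) (isFinitary_event _ _ _) (isFinitary_event _ _ _) isFinitary_univ g3 g4
        (fun ω K₀ hF => ⟨(hmem₀ ω K₀ hF).1, (hmem₀ ω K₀ hF).2.1, (hmem₀ ω K₀ hF).2.2, ?_, ?_,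
          hbond ω K₀ hF, Set.mem_univ _, (hmem₂ ω K₀ hF).1, (hmem₂ ω K₀ hF).2⟩)
        (hrow₀ _ rfl rfl rfl) ?_ ((junF_firstSCorner_up_le₂ p M x b w t z a τ hσ ha' _ _ _ _ _ _ _ _ _ _).trans hrow₂)
      · have h3 := firstSOpen_exit_mem M x b w t z a c τ hF huz hw0
        rwa [endX, if_pos rfl] at h3
      · obtain ⟨h0', -⟩ := hF.conn_midS 0 hσ ha'
        rw [event_ge]; exact mem_openConnGe_one_of_ne h0' (fun h => hx h.symm)
      · refine (junF_firstSOpen_xb_le₄ p M x b w t z a τ hσ ha' _ _ _ _ _ _ _ _ _ _).trans ?_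
        rw [hwu]
        exact piPerc_midS_zero_one_ne_le_blockAiotaSt p hb (fun h => huz h.symm) _
  · refine nonempty_jPkg_firstSOpen_core p M x b w t z a c τ κ hb hσ ha' X0 X1 X2
      (endX a₀ (b (0 : Fin (M + 1)).castSucc).1 (w (0 : Fin (M + 1)).castSucc) (z (0 : Fin (M + 1)).castSucc))
      (event (ge 0) (b (0 : Fin (M + 1)).castSucc).2 (t (0 : Fin (M + 1)).castSucc))
      (event (eq 1) (t (0 : Fin (M + 1)).castSucc) (z (0 : Fin (M + 1)).castSucc)) Set.univ E3 E4 f0 f1 f2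
      (isFinitary_endX _ _ _ _) (isFinitary_event _ _ _) (isFinitary_event _ _ _) isFinitary_univ g3 g4
      (fun ω K₀ hF => ⟨(hmem₀ ω K₀ hF).1, (hmem₀ ω K₀ hF).2.1, (hmem₀ ω K₀ hF).2.2,
        firstSOpen_exit_mem M x b w t z a c τ hF huz hw0, ?_, hbond ω K₀ hF, Set.mem_univ _,
        (hmem₂ ω K₀ hF).1, (hmem₂ ω K₀ hF).2⟩)
      (hrow₀ _ rfl rfl rfl) ?_ ((junF_firstSCorner_up_le₂ p M x b w t z a τ hσ ha' _ _ _ _ _ _ _ _ _ _).trans hrow₂)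
    · obtain ⟨h0', -⟩ := hF.conn_midS 0 hσ ha'
      rw [event_ge]; exact mem_openConnGe_zero_of_mem h0'
    · refine (junF_firstSOpen_xb_le₄ p M x b w t z a τ hσ ha' _ _ _ _ _ _ _ _ _ _).trans ?_
      rw [endX, if_neg h0]
      obtain h1 | h2 : a₀ = 1 ∨ a₀ = 2 := by
        fin_cases a₀
        · exact absurd rfl h0
        · exact Or.inl rfl
        · exact Or.inr rfl
      · subst h1
        obtain ⟨κ', hκ'⟩ := (zdGraph_adj_iff_stepVec _ _).1 (hw1 rfl)
        exact piPerc_midS_one_one_le_blockAiotaSt p hb hκ' _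
      · subst h2
        exact piPerc_midS_two_one_le_blockAiotaSt p hb _

/-- **Cells `(a_0, 2, a_1)`, `a_0 ∈ {0,1,2}`, `a_1 ∈ {1,2}`, variant `F‴`, of the first junction, ON THE CORNER
`w_1 = t_0`**: target `P^{S,a_0}(u_0,w_0) · (A^{κ,a_0,2,*}(u_0,w_0,t_0,z_0) · A♯^{2,a_1}(t_0,z_0,w_1,u_1))`.
[cite: FitznerVanDerHofstad2017, §6.1 (6.4)–(6.10), "Case a = 0 / 1 / ≥ 2", "Case b = 1, ≥ 2" (arXiv:1506.07977v2 pp. 58–59); §5.1 (5.1)–(5.4) (pp. 46–48); App. B (pp. 73–75); §4.4 (4.61), (4.64), text after (4.66) (pp. 41–42)] -/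
theorem nonempty_jPkg_firstS_two_corner (κ : Fin d × Bool)
    (hb : (b (0 : Fin (M + 1)).castSucc).2 = (b (0 : Fin (M + 1)).castSucc).1 + stepVec κ) (hσ : (τ 0).1 = false)
    (hc2 : (τ 0).2 = 2) (a₀ : Fin 3) (ha : a (0 : Fin (M + 1)).castSucc = Sum.inl a₀) {a' : Fin 3}
    (ha' : a (0 : Fin (M + 1)).succ = Sum.inl a') (ha'0 : a' ≠ 0)
    (hwt : w (0 : Fin (M + 1)).succ = t (0 : Fin (M + 1)).castSucc) :
    Nonempty (JPkg p (jctx M x b w t z a τ (0 : Fin (M + 1)).castSucc) (JFacts M x b w t z a c τ)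
      (blockPS (Letters.perc d p) a₀ (b (0 : Fin (M + 1)).castSucc).1 (w (0 : Fin (M + 1)).castSucc) *
        (blockAiotaSt (Letters.perc d p) κ a₀ 2 (b (0 : Fin (M + 1)).castSucc).1 (w (0 : Fin (M + 1)).castSucc)
            (t (0 : Fin (M + 1)).castSucc) (z (0 : Fin (M + 1)).castSucc) *
          blockASharp (Letters.perc d p) 2 a' (t (0 : Fin (M + 1)).castSucc) (z (0 : Fin (M + 1)).castSucc)
            (w (0 : Fin (M + 1)).succ) (b (0 : Fin (M + 1)).succ).1))) := by
  -- degenerate parameters: the piece is empty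
  by_cases hP : (t (0 : Fin (M + 1)).castSucc ≠ (b (0 : Fin (M + 1)).succ).1 ∧
      (a' ≠ 0 → w (0 : Fin (M + 1)).succ ≠ (b (0 : Fin (M + 1)).succ).1) ∧
      ((τ 0).2 = 0 → t (0 : Fin (M + 1)).castSucc = z (0 : Fin (M + 1)).castSucc) ∧
      ((τ 0).2 = 1 → (zdGraph d).Adj (t (0 : Fin (M + 1)).castSucc) (z (0 : Fin (M + 1)).castSucc))) ∧
      (b (0 : Fin (M + 1)).castSucc).1 ≠ t (0 : Fin (M + 1)).castSucc ∧
      (b (0 : Fin (M + 1)).castSucc).1 ≠ z (0 : Fin (M + 1)).castSucc ∧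
      (b (0 : Fin (M + 1)).castSucc).2 ≠ z (0 : Fin (M + 1)).castSucc ∧
      ((b (0 : Fin (M + 1)).castSucc).1 = 0 → w (0 : Fin (M + 1)).castSucc = 0) ∧
      (a₀ = 0 → w (0 : Fin (M + 1)).castSucc = (b (0 : Fin (M + 1)).castSucc).1) ∧
      (a₀ = 1 → (zdGraph d).Adj (b (0 : Fin (M + 1)).castSucc).1 (w (0 : Fin (M + 1)).castSucc)) ∧
      (a₀ = 2 → (b (0 : Fin (M + 1)).castSucc).1 ≠ w (0 : Fin (M + 1)).castSucc) ∧
      t (0 : Fin (M + 1)).castSucc ≠ z (0 : Fin (M + 1)).castSucc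
  swap
  · refine ⟨JPkg.vacuous p _ _ (fun ω K₀ hF => hP ?_) _⟩
    obtain ⟨-, hty, hut, huz, hvz, hcan, hw0, hw1, hw2, hw', -, hc0', hcn, hc1', -⟩ :=
      firstSOpen_facts M x b w t z a c τ hF hσ ha ha'
    exact ⟨⟨hty, hw', hc0', fun h => (hc1' h).1⟩, hut, huz, hvz, hcan, hw0, hw1, hw2, hcn (by rw [hc2]; decide)⟩
  obtain ⟨hQ, hut, huz, hvz, hcan, hw0, hw1, hw2, htz⟩ := hP
  obtain ⟨X0, X1, X2, f0, f1, f2, hmem₀, hrow₀⟩ :=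
    first_startLetter_gl p M x b w t z a c τ glFirstS3 true false (.lo 0) rfl rfl rfl ha hcan hw0 hw1 hw2
  obtain ⟨E3, E4, g3, g4, hmem₂, hrow₂⟩ :=
    midS_cornerLetter_piPerc p M x b w t z a c τ 0 hσ ha' ha'0 2 hwt hQ hc2
  refine nonempty_jPkg_firstSOpen_core p M x b w t z a c τ κ hb hσ ha' X0 X1 X2
    (endX a₀ (b (0 : Fin (M + 1)).castSucc).1 (w (0 : Fin (M + 1)).castSucc) (z (0 : Fin (M + 1)).castSucc))
    (event (ge 0) (b (0 : Fin (M + 1)).castSucc).2 (t (0 : Fin (M + 1)).castSucc))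
    (event (ge 2) (t (0 : Fin (M + 1)).castSucc) (z (0 : Fin (M + 1)).castSucc)) Set.univ E3 E4 f0 f1 f2
    (isFinitary_endX _ _ _ _) (isFinitary_event _ _ _) (isFinitary_event _ _ _) isFinitary_univ g3 g4
    (fun ω K₀ hF => ⟨(hmem₀ ω K₀ hF).1, (hmem₀ ω K₀ hF).2.1, (hmem₀ ω K₀ hF).2.2,
      firstSOpen_exit_mem M x b w t z a c τ hF huz hw0, ?_, ?_, Set.mem_univ _, (hmem₂ ω K₀ hF).1,
      (hmem₂ ω K₀ hF).2⟩)
    (hrow₀ _ rfl rfl rfl) ?_ ((junF_firstSCorner_up_le₂ p M x b w t z a τ hσ ha' _ _ _ _ _ _ _ _ _ _).trans hrow₂)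
  · obtain ⟨h0, -⟩ := hF.conn_midS 0 hσ ha'
    rw [event_ge]; exact mem_openConnGe_zero_of_mem h0
  · obtain ⟨-, h1, -⟩ := hF.conn_midS 0 hσ ha'
    obtain ⟨-, -, -, -, -, -, -, -, -, -, -, -, -, -, hc2'⟩ := firstSOpen_facts M x b w t z a c τ hF hσ ha ha'
    rw [event_ge]
    exact mem_openConnGe_two_of_notMem h1 htz fun hm => hc2' hc2 (hF.witness_subset _ 1 hm)
  · refine (junF_firstSOpen_xb_le₄ p M x b w t z a τ hσ ha' _ _ _ _ _ _ _ _ _ _).trans ?_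
    unfold endX
    split_ifs with h0
    · subst h0
      rw [hw0 rfl]
      exact piPerc_midS_zero_two_le_blockAiotaSt p hb (fun h => hut h.symm) (fun h => huz h.symm) _
    · obtain h1 | h2 : a₀ = 1 ∨ a₀ = 2 := by
        fin_cases a₀
        · exact absurd rfl h0
        · exact Or.inl rfl
        · exact Or.inr rfl
      · subst h1
        obtain ⟨κ', hκ'⟩ := (zdGraph_adj_iff_stepVec _ _).1 (hw1 rfl)
        exact piPerc_midS_one_two_le_blockAiotaSt p hb hκ' _
      · subst h2
        exact piPerc_midS_two_two_le_blockAiotaSt p hb _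

/-- **All corner cells of the first junction, variant `F‴`, dispatched on the inner class `c = (τ 0).2`**, primed
entry letter: target `P^{S,a_0}(u_0,w_0) · (A'^{κ,a_0,c,*}(u_0,w_0,t_0,z_0) · A♯^{c,a_1}(t_0,z_0,w_1,u_1))`,
`a_1 ∈ {1,2}`, `w_1 = t_0`.
[cite: FitznerVanDerHofstad2017, §6.1 (6.4)–(6.10), "Case a = 0 / 1 / ≥ 2", "Case b = 1, ≥ 2" (arXiv:1506.07977v2 pp. 58–59); §5.1 (5.1)–(5.4) (pp. 46–48); App. B (pp. 73–75); §4.4 (4.61), (4.64), text after (4.66) (pp. 41–42)] -/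
theorem nonempty_jPkg_firstS_corner' (κ : Fin d × Bool)
    (hb : (b (0 : Fin (M + 1)).castSucc).2 = (b (0 : Fin (M + 1)).castSucc).1 + stepVec κ) (hσ : (τ 0).1 = false)
    (c₁ : Fin 3) (hc : (τ 0).2 = c₁) (a₀ : Fin 3) (ha : a (0 : Fin (M + 1)).castSucc = Sum.inl a₀) {a' : Fin 3}
    (ha' : a (0 : Fin (M + 1)).succ = Sum.inl a') (ha'0 : a' ≠ 0)
    (hwt : w (0 : Fin (M + 1)).succ = t (0 : Fin (M + 1)).castSucc) :
    Nonempty (JPkg p (jctx M x b w t z a τ (0 : Fin (M + 1)).castSucc) (JFacts M x b w t z a c τ)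
      (blockPS (Letters.perc d p) a₀ (b (0 : Fin (M + 1)).castSucc).1 (w (0 : Fin (M + 1)).castSucc) *
        (blockAiotaSt' (Letters.perc d p) κ a₀ c₁ (b (0 : Fin (M + 1)).castSucc).1 (w (0 : Fin (M + 1)).castSucc)
            (t (0 : Fin (M + 1)).castSucc) (z (0 : Fin (M + 1)).castSucc) *
          blockASharp (Letters.perc d p) c₁ a' (t (0 : Fin (M + 1)).castSucc) (z (0 : Fin (M + 1)).castSucc)
            (w (0 : Fin (M + 1)).succ) (b (0 : Fin (M + 1)).succ).1))) := by
  obtain h0 | h1 | h2 : c₁ = 0 ∨ c₁ = 1 ∨ c₁ = 2 := by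
    fin_cases c₁
    · exact Or.inl rfl
    · exact Or.inr (Or.inl rfl)
    · exact Or.inr (Or.inr rfl)
  · subst h0
    exact nonempty_jPkg_firstS_zero_corner' p M x b w t z a c τ κ hb hσ hc a₀ ha ha' ha'0 hwt
  · subst h1
    rw [blockAiotaSt'_of_ne _ _ (fun h => absurd h.2 (by decide))]
    exact nonempty_jPkg_firstS_one_corner p M x b w t z a c τ κ hb hσ hc a₀ ha ha' ha'0 hwt
  · subst h2
    rw [blockAiotaSt'_of_ne _ _ (fun h => absurd h.2 (by decide))]
    exact nonempty_jPkg_firstS_two_corner p M x b w t z a c τ κ hb hσ hc a₀ ha ha' ha'0 hwt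

/-- **THE CORNER CELL OF THE FIRST JUNCTION** — the slot `hR′₀` of `NobleBoundsNDispatchReg.nonempty_jPkg_first_reg`
(kind `false`, `a_1 ≠ 0`, `w_1 = t_0`) DISCHARGED against the Sharp payload: target
`P^{S,a_0}(u_0,w_0) · blockXRPrime L (τ 0).2 …` (b2b-lace LEMMAS node N76-X2-D77, leaf T2a-first).
[cite: FitznerVanDerHofstad2017, §6.1 (6.4)–(6.10), "Case a = 0 / 1 / ≥ 2", "Case b = 1, ≥ 2" (arXiv:1506.07977v2 pp. 58–59); §5.1 (5.1)–(5.4) (pp. 46–48); App. B (pp. 73–75); §4.4 (4.61), (4.64), text after (4.66) (pp. 41–42)] -/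
theorem nonempty_jPkg_firstS_corner (κ : Fin d × Bool)
    (hb : (b (0 : Fin (M + 1)).castSucc).2 = (b (0 : Fin (M + 1)).castSucc).1 + stepVec κ) (a₀ a' : Fin 3)
    (ha : a (0 : Fin (M + 1)).castSucc = Sum.inl a₀) (ha' : a (0 : Fin (M + 1)).succ = Sum.inl a')
    (hσ : (τ 0).1 = false) (ha'0 : a' ≠ 0) (hwt : w (0 : Fin (M + 1)).succ = t (0 : Fin (M + 1)).castSucc) :
    Nonempty (JPkg p (jctx M x b w t z a τ (0 : Fin (M + 1)).castSucc) (JFacts M x b w t z a c τ)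
      (blockPS (Letters.perc d p) a₀ (b (0 : Fin (M + 1)).castSucc).1 (w (0 : Fin (M + 1)).castSucc) *
        blockXRPrime (Letters.perc d p) (τ 0).2 κ a₀ a' (b (0 : Fin (M + 1)).castSucc).1
          (w (0 : Fin (M + 1)).castSucc) (t (0 : Fin (M + 1)).castSucc) (z (0 : Fin (M + 1)).castSucc)
          (w (0 : Fin (M + 1)).succ) (b (0 : Fin (M + 1)).succ).1)) := by
  unfold blockXRPrime
  exact nonempty_jPkg_firstS_corner' p M x b w t z a c τ κ hb hσ (τ 0).2 rfl a₀ ha ha' ha'0 hwt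

end Packages

end Summit.CriticalPhenomena.LaceExpansionHighD.NobleBlocks

end
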